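import Summits.QuantumFields.YangMills.Theorems.UnitScaleTiltHalvingP1FlatCoreJunction
import Summits.QuantumFields.YangMills.Theorems.UnitScaleTiltHalvingP1FlatCoreTopCubeGeometry
import Summits.QuantumFields.YangMills.Theorems.UnitScaleTiltHalvingCompetitorMapFibre
import Literature.MathematicalPhysics.QuantumFieldTheory.Balaban1983to89.B8Prop5SocketDatum
import HarnessLib

/-!
# `hSupU` PROGRAMME (LEAD-H BOARD v2 ∕ RULING L-10), row [R-j] «TORUS DESCENT OF THE COMPOSITE GAUGE»: the door's torus gauge
# `g := (u₁ ∘ rep)⁻¹ · ĝJ` (N05's LOWER Landau gauge `u₁` on `ℤ³` read through the window representative `rep s = lift x₀ + rel x₀ s`, times J3's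
# `SU(2)` pre-gauge `ĝJ`) and its rows [R-c] `hg`, [R-a] `hAchart`, near-`1`, FROM THE DATUM `(u₁, W, A)` OF [Balaban1985RegularSpaces] THEOREM 4
# AT `K − n − 1` LEVELS in its output letters `mgauge 1 u₁ W = V`, `W_b = cfgExp η A_b`, `‖A_b‖ ≤ c(Lʲη)⁻¹` (lit ✓`B8Thm4AtLandau138.thm4_exists_all_levels_landau138`)

Route `UnitScaleTilt`, crux K1 child «MinimiserStabilityRegPr» (stmt-QuantumFields-19200), registered stub `stub_halvingStep` (`BirthV10`), H = `hSupU`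
(✓`HalvingP1FlatPillarRoomOfSuppliers.hP1room_of_suppliers` ∘ ✓`HalvingStubOfHP1Room.stub_halvingStep_of_hP1room`), per-site ∃-block ⟸
✓`HalvingP1FlatCoreSupplierDoor.hSup_of_contentRows` over nine content rows on the data `(g, κf, ν, gs′, A, λ)`.  Cell `ym3-torus`, width seat
`ym-ust-19200-w3` (gen 7).  `--supports stmt-QuantumFields-19200 --as helper`; THEOREMS ONLY (0 `def`, 0 `sorry`); count-neutral.

WHY (LOCATE (q-ii), bus 2026-08-28T15:12Z ∕ door author 15:13Z): the top step ✓`P1FlatCoreTopStepTorus.hFP_kLevel_top_RD` reads its input one-form `A`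
through `hA : ∀ j ≤ k, ∀ x ∈ Ω j, Lʲη·‖A x μ‖ ≤ c_A` — letter for letter lit ✓`B8Prop5ExistsZdLan.hA_of_cond169`, i.e. print's INDUCTIVE HYPOTHESIS
(1.69) p. 88 «`U₁ = U′^{u₁⁻¹} = e^{iηA}`, `|A| < B₁(α₀ + α₁)(Lʲη)⁻¹` on `Ω_j`, `j < k`» for the field ALREADY GAUGE-FIXED THROUGH LEVEL `k − 1` by `u₁`; the
raw pre-gauged field `V = (U^{ĝJ})♯` of ✓`P1FlatCorePreGauge.exists_preGauge_flat` is only `k`-uniformly near `1`.  Hence the door's torus gauge must carry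
`u₁`: on the torus, through the window representative (`u₁` is not periodic; the window does not wrap, `hroomW`).

WHAT IS PROVED (sorry-free, no definition; `k := K − n`, `U♯ := unitsField (toUField U)`, `ĝJ := toUnits ∘ suIncl ∘ gJ`,
`g := fun s ↦ (u₁ (lift x₀ + rel x₀ s))⁻¹ · ĝJ s` written out in every statement):
* §1 `gaugeActT_mul_left` — `(c·u) • V (b) = c(b₋) · (u • V)(b) · c(b₊)⁻¹` (any `Params`, any group).
* §2 `gaugeActT_descent_window` — on a window bond `⟨0 + z, ν⟩` (`z ∈ □₀`, both torus end-points in the route's level-`0` cube):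
  `(U♯)^{g}⟨0+z, ν⟩ = u₁(z)⁻¹ · (U♯)^{ĝ}⟨0+z, ν⟩ · u₁(z + e_ν)` (✓`rep_transl_eq` ∕ ✓`rep_shift`); `gaugeActT_descent_eq_of_mgauge` — with Theorem 4's
  `mgauge 1 u₁ W = pull (U^{gJ})♯ 0`: `(U♯)^{g}⟨0+z, ν⟩ = W z ν`.
* §3 ★★ `hAchart_of_datum` — the door's [R-a] `hAchart` VERBATIM for Theorem 4's `A` and the composite `g`, from `W_b = cfgExp η A_b` on the bonds of `□₀`
  (or on `SideTouches Ω₀ ⊇ □₀`, Theorem 4's shape: `hAchart_of_sideTouches`); ★ `hg_of_datum` — [R-c] `hg` from `u₁` `SU(2)`-valued (the τ-thread one storey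
  down) and `gJ` `SU(2)`-valued (by type); ★ `norm_descent_sub_one_le` — near-`1` of `(U♯)^{g}` on the window bonds from `η‖A_b‖ ≤ c`: `≤ exp c − 1`.
* §4 `mem_cubeSetM_of_block_eq` (the top block of `x₀` lies in the route's `□₀` and `□_k`) and ★ `hW1near_of_datum` — the near-`1` on the TORUS bonds of the
  top block of `x₀` (the displayed `hW1near` of ✓`HalvingP1FlatCoreSupplierFramesSU2.hCsu_of_near(_eta)`, [R-g]) from `W = cfgExp η A`, `η‖A‖ ≤ c` on `□_k`.

HONEST SCOPE: torus∕`ℤ³` bookkeeping; the datum `(u₁, W, A)` and its rows are DISPLAYED (supplier: Theorem 4 at `K − n − 1` levels on `V`, row [R-i]); nothing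
of Theorem 4 ∕ Proposition 5, of `core′`, the stub or the crux is proved here.  Rung R3 (YM₃ on T³), NOT the Clay problem; YM gap NOT proved.

References: T. Bałaban, CMP **99** (1985) 75–102 [Balaban1985RegularSpaces] ((1.68)–(1.69) p.88, Thm 4 p.88, Prop. 5 (1.107) p.94); CMP **102** (1985)
277–309 [Balaban1985Variational] ((144)–(147) p.300, (152) p.301); CMP **109** (1987) 249–301 [Balaban1987RG1] ((0.1) p.251).
-/

set_option autoImplicit false

noncomputable section

open scoped Matrix.Norms.L2Operator

namespace Summit.QuantumFields.YangMills.Theorems.HalvingP1FlatCoreSupplierGaugeDescent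

open Literature.MathematicalPhysics.QuantumFieldTheory.Balaban1983to89
open Literature.MathematicalPhysics.QuantumFieldTheory.Balaban1983to89.T3ContinuumYM3Torus
open NormedSpace
open Complex (I)
open B5Eq117TorusCarriers (Mk)
open B5Eq118OneStroke (iterBlockOf)
open B5Prop12FieldsLattice (distSite distSite_self)
open B7Prop1Explicit renaming Site → LSite
open B7Prop1Explicit (e expUnit val_expUnit)
open B7Eq92Concrete (mgauge mgauge_apply Rc Rc_one_apply)
open B8Eq131Cubes (cube gs)
open B8Eq140Level (SideTouches)
open B8Eq184Proof (cfgExp)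
open B8Prop5SocketDatum (sideTouches_pair_of_mem)
open B10Eq27TorusAxialLog (transl transl_add_e rel pull pull_apply unitsField toUField suIncl gaugeActT gaugeActT_apply)
open B15Eq112TorusCover (lift)
open FlatCubeSequenceAligned (cubeSetM cubeFinM radM mem_cubeFinM_of_dist)
open HalvingP1FlatCoreJunction (rep_transl_eq rep_shift)
open P1FlatCoreCubeInclusion (transl_zero_eq_cover cover_lift_add_rel lift_add_rel_mem_cube_zero mem_cube_of_cover_mem_cubeSetM)
open P1FlatCoreTopCubeGeometry (mem_cubeSetM_zero_of_dist_le)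
open HalvingCompetitorMapFibre (unitsField_toUField_gaugeAct)
open HalvingCompetitorMapFramesSU2 (su2_pred_mul su2_pred_inv)
open Summit.QuantumFields.YangMills.Theorems (FlatMinimizerH.le_T3)

/-! ## §1 Left multiplication of a gauge transformation by a frame field -/

section Algebra

variable {P : Params} {j : ℕ} {G : Type*} [Group G]

/-- `(c·u) • V` on a bond: `c(b₋)·(u • V)(b)·c(b₊)⁻¹`. [cite: Balaban1985Averaging, (8) p.19] -/
theorem gaugeActT_mul_left (c u : GaugeTransf P j G) (V : GaugeField P j G) (b : PBond P j) :
    gaugeActT (fun s => c s * u s : GaugeTransf P j G) V b = c b.src * gaugeActT u V b * (c b.tgt)⁻¹ := by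
  simp only [gaugeActT_apply, mul_inv_rev]
  group

end Algebra

/-! ## §2 The composite gauge on the window bonds -/

section Torus

variable {F : T3Family} {n K : ℕ}

/-- **THE COMPOSITE GAUGE ON A WINDOW BOND.**  For a `ℤ³` frame field `u₁`, a torus gauge `ĝ` and a torus field `W₀`: on the bond `⟨0 + z, ν⟩` with
`z ∈ □₀ = cube L a M′ ρ′ k 0` and both torus end-points in the route's level-`0` cube, the composite gauge `s ↦ (u₁ (lift x₀ + rel x₀ s))⁻¹·ĝ s` acts as
`u₁(z)⁻¹ · (W₀^{ĝ})⟨0+z, ν⟩ · u₁(z + e_ν)` (the representatives of the end-points are `z` and `z + e_ν`). [cite: Balaban1987RG1, (0.1) p.251; Balaban1985Averaging, (8) p.19] -/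
theorem gaugeActT_descent_window (x₀ : Site (F.P K) 0) (ρ S M : ℕ) (hM : 1 ≤ M)
    {a : LSite (F.P K).d} {M' ρ' : ℕ} (h0 : ρ + M ≤ ρ' + 1) (h1 : (F.P K).L + S + M ≤ ρ' + 2)
    (ha : ∀ ν, a ν ≤ ((iterBlockOf (K - n) x₀ ν).val : ℤ) ∧ ((iterBlockOf (K - n) x₀ ν).val : ℤ) ≤ a ν + M' - 1)
    (hroomW : 2 * ((F.P K).L ^ (K - n) * (M' + 1) + ρ' * gs (F.P K).L (K - n)) ≤ (F.P K).sitesPerDir 0)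
    {G : Type*} [Group G] (u₁ : LSite (F.P K).d → G) (ĝ : GaugeTransf (F.P K) 0 G) (W₀ : GaugeField (F.P K) 0 G)
    {z : LSite (F.P K).d} (hz : z ∈ cube (F.P K).L a M' ρ' (K - n) 0) (ν : Fin (F.P K).d)
    (hs1 : transl (0 : Site (F.P K) 0) z ∈ cubeSetM x₀ (K - n) ρ S M 0) (hs2 : (transl (0 : Site (F.P K) 0) z).shift ν ∈ cubeSetM x₀ (K - n) ρ S M 0) :
    gaugeActT (fun s => (u₁ (lift (F.P K) x₀ + rel x₀ s))⁻¹ * ĝ s : GaugeTransf (F.P K) 0 G) W₀ ⟨transl 0 z, ν⟩ =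
      (u₁ z)⁻¹ * gaugeActT ĝ W₀ ⟨transl 0 z, ν⟩ * u₁ (z + e ν) := by
  have hk : K - n ≤ (F.P K).m + (F.P K).K := FlatMinimizerH.le_T3 F n K
  have hz1 : lift (F.P K) x₀ + rel x₀ (transl (0 : Site (F.P K) 0) z) = z := rep_transl_eq hk hM h0 h1 ha hroomW hz hs1
  have hz2 : lift (F.P K) x₀ + rel x₀ ((transl (0 : Site (F.P K) 0) z).shift ν) = z + e ν := by
    rw [rep_shift hk hM h0 h1 ha hroomW hs1 ν hs2, hz1]
  rw [gaugeActT_mul_left (fun s => (u₁ (lift (F.P K) x₀ + rel x₀ s))⁻¹) ĝ W₀ ⟨transl 0 z, ν⟩]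
  simp only [PBond.tgt, hz1, hz2, inv_inv]

/-- **THE COMPOSITE GAUGE READS THEOREM 4's GAUGE-FIXED FIELD ON THE WINDOW.**  With `V := pull (U^{gJ})♯ 0` (J3's pre-gauged field on `ℤ³`) and Theorem 4's
datum `mgauge 1 u₁ W = V` (lit ✓`thm4_exists_all_levels_landau138`'s `∃ W, mgauge U₀ u W = U′` at `U₀ = 1`): `(U♯)^{g}⟨0+z, ν⟩ = W z ν` on the window bonds.
[cite: Balaban1985RegularSpaces, (1.68)-(1.69) p.88, Thm 4 p.88; Balaban1985Averaging, (55) p.27] -/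
theorem gaugeActT_descent_eq_of_mgauge (x₀ : Site (F.P K) 0) (ρ S M : ℕ) (hM : 1 ≤ M)
    {a : LSite (F.P K).d} {M' ρ' : ℕ} (h0 : ρ + M ≤ ρ' + 1) (h1 : (F.P K).L + S + M ≤ ρ' + 2)
    (ha : ∀ ν, a ν ≤ ((iterBlockOf (K - n) x₀ ν).val : ℤ) ∧ ((iterBlockOf (K - n) x₀ ν).val : ℤ) ≤ a ν + M' - 1)
    (hroomW : 2 * ((F.P K).L ^ (K - n) * (M' + 1) + ρ' * gs (F.P K).L (K - n)) ≤ (F.P K).sitesPerDir 0)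
    (U : GaugeField (F.P K) 0 (Matrix.specialUnitaryGroup (Fin 2) ℂ)) (gJ : GaugeTransf (F.P K) 0 (Matrix.specialUnitaryGroup (Fin 2) ℂ))
    (u₁ : LSite (F.P K).d → (Matrix (Fin 2) (Fin 2) ℂ)ˣ) (W : LSite (F.P K).d → Fin (F.P K).d → (Matrix (Fin 2) (Fin 2) ℂ)ˣ)
    (hWV : mgauge (1 : LSite (F.P K).d → Fin (F.P K).d → (Matrix (Fin 2) (Fin 2) ℂ)ˣ) u₁ W =
      pull (unitsField (toUField (GaugeField.gaugeAct gJ U))) 0)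
    {z : LSite (F.P K).d} (hz : z ∈ cube (F.P K).L a M' ρ' (K - n) 0) (ν : Fin (F.P K).d)
    (hs1 : transl (0 : Site (F.P K) 0) z ∈ cubeSetM x₀ (K - n) ρ S M 0) (hs2 : (transl (0 : Site (F.P K) 0) z).shift ν ∈ cubeSetM x₀ (K - n) ρ S M 0) :
    gaugeActT (fun s => (u₁ (lift (F.P K) x₀ + rel x₀ s))⁻¹ * Unitary.toUnits (suIncl (gJ s)) : GaugeTransf (F.P K) 0 (Matrix (Fin 2) (Fin 2) ℂ)ˣ)
        (unitsField (toUField U)) ⟨transl 0 z, ν⟩ = W z ν := by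
  rw [gaugeActT_descent_window x₀ ρ S M hM h0 h1 ha hroomW u₁ (fun s => Unitary.toUnits (suIncl (gJ s))) (unitsField (toUField U)) hz ν hs1 hs2,
    ← unitsField_toUField_gaugeAct, ← pull_apply (unitsField (toUField (GaugeField.gaugeAct gJ U))) 0 z ν, ← hWV, mgauge_apply, Pi.one_apply,
    Pi.one_apply, Rc_one_apply]
  group

/-! ## §3 The door's rows [R-a] `hAchart`, [R-c] `hg`, and the near-`1` of the composite -/

/-- ★★ **[R-a] `hAchart` FROM THEOREM 4's DATUM.**  If `W_b = cfgExp η A_b` on the bonds `⟨z, ν⟩`, `z ∈ □₀`, then the door's chart identity holds for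
Theorem 4's `A` and the composite gauge: `cfgExp η A z ν = (U♯)^{g}⟨0+z, ν⟩` on every window bond (✓`hSup_of_contentRows`' `hAchart` VERBATIM).
[cite: Balaban1985RegularSpaces, (1.69) p.88, Thm 4 p.88; Balaban1985Variational, (152) p.301] -/
theorem hAchart_of_datum (x₀ : Site (F.P K) 0) (ρ S M : ℕ) (hM : 1 ≤ M)
    {a : LSite (F.P K).d} {M' ρ' : ℕ} (h0 : ρ + M ≤ ρ' + 1) (h1 : (F.P K).L + S + M ≤ ρ' + 2)
    (ha : ∀ ν, a ν ≤ ((iterBlockOf (K - n) x₀ ν).val : ℤ) ∧ ((iterBlockOf (K - n) x₀ ν).val : ℤ) ≤ a ν + M' - 1)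
    (hroomW : 2 * ((F.P K).L ^ (K - n) * (M' + 1) + ρ' * gs (F.P K).L (K - n)) ≤ (F.P K).sitesPerDir 0)
    (U : GaugeField (F.P K) 0 (Matrix.specialUnitaryGroup (Fin 2) ℂ)) (gJ : GaugeTransf (F.P K) 0 (Matrix.specialUnitaryGroup (Fin 2) ℂ))
    (u₁ : LSite (F.P K).d → (Matrix (Fin 2) (Fin 2) ℂ)ˣ) (W : LSite (F.P K).d → Fin (F.P K).d → (Matrix (Fin 2) (Fin 2) ℂ)ˣ)
    (hWV : mgauge (1 : LSite (F.P K).d → Fin (F.P K).d → (Matrix (Fin 2) (Fin 2) ℂ)ˣ) u₁ W =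
      pull (unitsField (toUField (GaugeField.gaugeAct gJ U))) 0)
    {η : ℝ} {A : LSite (F.P K).d → Fin (F.P K).d → Matrix (Fin 2) (Fin 2) ℂ}
    (hWA : ∀ z ∈ cube (F.P K).L a M' ρ' (K - n) 0, ∀ ν : Fin (F.P K).d, W z ν = cfgExp η A z ν) :
    ∀ z ∈ cube (F.P K).L a M' ρ' (K - n) 0, ∀ ν' : Fin (F.P K).d,
      transl (0 : Site (F.P K) 0) z ∈ cubeSetM x₀ (K - n) ρ S M 0 → (transl (0 : Site (F.P K) 0) z).shift ν' ∈ cubeSetM x₀ (K - n) ρ S M 0 →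
      cfgExp η A z ν' = gaugeActT (fun s => (u₁ (lift (F.P K) x₀ + rel x₀ s))⁻¹ * Unitary.toUnits (suIncl (gJ s)) :
        GaugeTransf (F.P K) 0 (Matrix (Fin 2) (Fin 2) ℂ)ˣ) (unitsField (toUField U)) ⟨transl 0 z, ν'⟩ := by
  intro z hz ν' hs1 hs2
  rw [gaugeActT_descent_eq_of_mgauge x₀ ρ S M hM h0 h1 ha hroomW U gJ u₁ W hWV hz ν' hs1 hs2, hWA z hz ν']

/-- ★ **[R-a] FROM THEOREM 4's ROW IN ITS OWN SHAPE** «`∀ b ∈ {b | SideTouches Ω₀ b}`, `W b = cfgExp η A b ∧ …`» (lit ✓`thm4_exists_all_levels_landau138`'s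
last conjunct at `j = 0`) for any `Ω₀ ⊇ □₀` (`d = 3 ≥ 2`: every bond from a point of `Ω₀` is a side of a plaquette touching `Ω₀`,
lit ✓`B8Prop5SocketDatum.sideTouches_pair_of_mem`). [cite: Balaban1985RegularSpaces, p.77 (convention before (1.5)), Thm 4 p.88] -/
theorem hAchart_of_sideTouches (x₀ : Site (F.P K) 0) (ρ S M : ℕ) (hM : 1 ≤ M)
    {a : LSite (F.P K).d} {M' ρ' : ℕ} (h0 : ρ + M ≤ ρ' + 1) (h1 : (F.P K).L + S + M ≤ ρ' + 2)
    (ha : ∀ ν, a ν ≤ ((iterBlockOf (K - n) x₀ ν).val : ℤ) ∧ ((iterBlockOf (K - n) x₀ ν).val : ℤ) ≤ a ν + M' - 1)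
    (hroomW : 2 * ((F.P K).L ^ (K - n) * (M' + 1) + ρ' * gs (F.P K).L (K - n)) ≤ (F.P K).sitesPerDir 0)
    (U : GaugeField (F.P K) 0 (Matrix.specialUnitaryGroup (Fin 2) ℂ)) (gJ : GaugeTransf (F.P K) 0 (Matrix.specialUnitaryGroup (Fin 2) ℂ))
    (u₁ : LSite (F.P K).d → (Matrix (Fin 2) (Fin 2) ℂ)ˣ) (W : LSite (F.P K).d → Fin (F.P K).d → (Matrix (Fin 2) (Fin 2) ℂ)ˣ)
    (hWV : mgauge (1 : LSite (F.P K).d → Fin (F.P K).d → (Matrix (Fin 2) (Fin 2) ℂ)ˣ) u₁ W =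
      pull (unitsField (toUField (GaugeField.gaugeAct gJ U))) 0)
    {η : ℝ} {A : LSite (F.P K).d → Fin (F.P K).d → Matrix (Fin 2) (Fin 2) ℂ} {Ω₀ : Set (LSite (F.P K).d)}
    (hΩ₀ : cube (F.P K).L a M' ρ' (K - n) 0 ⊆ Ω₀) {Q : LSite (F.P K).d × Fin (F.P K).d → Prop}
    (hrow : ∀ b ∈ {b : LSite (F.P K).d × Fin (F.P K).d | SideTouches Ω₀ b.1 b.2}, W b.1 b.2 = cfgExp η A b.1 b.2 ∧ Q b) :
    ∀ z ∈ cube (F.P K).L a M' ρ' (K - n) 0, ∀ ν' : Fin (F.P K).d,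
      transl (0 : Site (F.P K) 0) z ∈ cubeSetM x₀ (K - n) ρ S M 0 → (transl (0 : Site (F.P K) 0) z).shift ν' ∈ cubeSetM x₀ (K - n) ρ S M 0 →
      cfgExp η A z ν' = gaugeActT (fun s => (u₁ (lift (F.P K) x₀ + rel x₀ s))⁻¹ * Unitary.toUnits (suIncl (gJ s)) :
        GaugeTransf (F.P K) 0 (Matrix (Fin 2) (Fin 2) ℂ)ˣ) (unitsField (toUField U)) ⟨transl 0 z, ν'⟩ := by
  have hd2 : 2 ≤ (F.P K).d := by rw [T3Family.P_d]; norm_num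
  refine hAchart_of_datum x₀ ρ S M hM h0 h1 ha hroomW U gJ u₁ W hWV fun z hz ν => ?_
  exact (hrow (z, ν) (sideTouches_pair_of_mem hd2 (hΩ₀ hz) ν).1).1

/-- ★ **[R-c] `hg` FROM THE DATUM**: the composite gauge is `SU(2)`-valued as soon as `u₁` is (the τ-clause of the lower induction: `u₁ = ∏ e^{iλ_m}`, each
`λ_m` Hermitian traceless) — `gJ` is `SU(2)`-valued by type. [cite: Balaban1985RegularSpaces, (1.68) p.88, Prop. 5 (1.107) p.94] -/
theorem hg_of_datum (x₀ : Site (F.P K) 0) (gJ : GaugeTransf (F.P K) 0 (Matrix.specialUnitaryGroup (Fin 2) ℂ))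
    (u₁ : LSite (F.P K).d → (Matrix (Fin 2) (Fin 2) ℂ)ˣ)
    (hu₁ : ∀ z, ((u₁ z : (Matrix (Fin 2) (Fin 2) ℂ)ˣ) : Matrix (Fin 2) (Fin 2) ℂ) ∈ Matrix.specialUnitaryGroup (Fin 2) ℂ) :
    ∀ s : Site (F.P K) 0, (((fun s => (u₁ (lift (F.P K) x₀ + rel x₀ s))⁻¹ * Unitary.toUnits (suIncl (gJ s)) :
        GaugeTransf (F.P K) 0 (Matrix (Fin 2) (Fin 2) ℂ)ˣ) s : (Matrix (Fin 2) (Fin 2) ℂ)ˣ) : Matrix (Fin 2) (Fin 2) ℂ) ∈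
      Matrix.specialUnitaryGroup (Fin 2) ℂ := by
  intro s
  have hg : ((Unitary.toUnits (suIncl (gJ s)) : (Matrix (Fin 2) (Fin 2) ℂ)ˣ) : Matrix (Fin 2) (Fin 2) ℂ) ∈ Matrix.specialUnitaryGroup (Fin 2) ℂ :=
    (gJ s).2
  exact Matrix.mem_specialUnitaryGroup_iff.2 (su2_pred_mul _ _ (su2_pred_inv _ (Matrix.mem_specialUnitaryGroup_iff.1 (hu₁ _)))
    (Matrix.mem_specialUnitaryGroup_iff.1 hg))

/-- The exponential chart is `(e^c − 1)`-close to `1` when `η‖A_b‖ ≤ c`: `‖cfgExp η A z ν − 1‖ ≤ exp c − 1`. [cite: Balaban1985RegularSpaces, (1.36) p.82] -/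
theorem norm_cfgExp_sub_one_le {d : ℕ} {η : ℝ} (hη : 0 ≤ η) {A : LSite d → Fin d → Matrix (Fin 2) (Fin 2) ℂ} {c : ℝ} (z : LSite d) (ν : Fin d)
    (hA : η * ‖A z ν‖ ≤ c) :
    ‖((cfgExp η A z ν : (Matrix (Fin 2) (Fin 2) ℂ)ˣ) : Matrix (Fin 2) (Fin 2) ℂ) - 1‖ ≤ Real.exp c - 1 := by
  rw [cfgExp, val_expUnit]
  have h1 : ‖I • (η • A z ν)‖ ≤ c := by
    rw [norm_smul, Complex.norm_I, one_mul, norm_smul, Real.norm_of_nonneg hη]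
    exact hA
  calc ‖exp (I • (η • A z ν)) - 1‖ ≤ Real.exp ‖I • (η • A z ν)‖ - 1 := norm_exp_sub_one_le_exp_norm_sub_one _
    _ ≤ Real.exp c - 1 := by linarith [Real.exp_le_exp.2 h1]

/-- ★ **NEAR-`1` OF THE COMPOSITE-GAUGED FIELD ON THE WINDOW BONDS** from Theorem 4's size row at level `0` (`η‖A_b‖ ≤ c` on `□₀`):
`‖(U♯)^{g}⟨0+z, ν⟩ − 1‖ ≤ e^c − 1` — the `hnear1`∕`hW1near`-type input of the generic [R-a] and of ✓`HalvingP1FlatCoreSupplierFramesSU2.hCsu_of_near`.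
[cite: Balaban1985RegularSpaces, (1.36) p.82, (1.69) p.88] -/
theorem norm_descent_sub_one_le (x₀ : Site (F.P K) 0) (ρ S M : ℕ) (hM : 1 ≤ M)
    {a : LSite (F.P K).d} {M' ρ' : ℕ} (h0 : ρ + M ≤ ρ' + 1) (h1 : (F.P K).L + S + M ≤ ρ' + 2)
    (ha : ∀ ν, a ν ≤ ((iterBlockOf (K - n) x₀ ν).val : ℤ) ∧ ((iterBlockOf (K - n) x₀ ν).val : ℤ) ≤ a ν + M' - 1)
    (hroomW : 2 * ((F.P K).L ^ (K - n) * (M' + 1) + ρ' * gs (F.P K).L (K - n)) ≤ (F.P K).sitesPerDir 0)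
    (U : GaugeField (F.P K) 0 (Matrix.specialUnitaryGroup (Fin 2) ℂ)) (gJ : GaugeTransf (F.P K) 0 (Matrix.specialUnitaryGroup (Fin 2) ℂ))
    (u₁ : LSite (F.P K).d → (Matrix (Fin 2) (Fin 2) ℂ)ˣ) (W : LSite (F.P K).d → Fin (F.P K).d → (Matrix (Fin 2) (Fin 2) ℂ)ˣ)
    (hWV : mgauge (1 : LSite (F.P K).d → Fin (F.P K).d → (Matrix (Fin 2) (Fin 2) ℂ)ˣ) u₁ W =
      pull (unitsField (toUField (GaugeField.gaugeAct gJ U))) 0)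
    {η : ℝ} (hη : 0 ≤ η) {A : LSite (F.P K).d → Fin (F.P K).d → Matrix (Fin 2) (Fin 2) ℂ} {c : ℝ}
    (hWA : ∀ z ∈ cube (F.P K).L a M' ρ' (K - n) 0, ∀ ν : Fin (F.P K).d, W z ν = cfgExp η A z ν ∧ η * ‖A z ν‖ ≤ c)
    {z : LSite (F.P K).d} (hz : z ∈ cube (F.P K).L a M' ρ' (K - n) 0) (ν : Fin (F.P K).d)
    (hs1 : transl (0 : Site (F.P K) 0) z ∈ cubeSetM x₀ (K - n) ρ S M 0) (hs2 : (transl (0 : Site (F.P K) 0) z).shift ν ∈ cubeSetM x₀ (K - n) ρ S M 0) :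
    ‖((gaugeActT (fun s => (u₁ (lift (F.P K) x₀ + rel x₀ s))⁻¹ * Unitary.toUnits (suIncl (gJ s)) : GaugeTransf (F.P K) 0 (Matrix (Fin 2) (Fin 2) ℂ)ˣ)
        (unitsField (toUField U)) ⟨transl 0 z, ν⟩ : (Matrix (Fin 2) (Fin 2) ℂ)ˣ) : Matrix (Fin 2) (Fin 2) ℂ) - 1‖ ≤ Real.exp c - 1 := by
  rw [gaugeActT_descent_eq_of_mgauge x₀ ρ S M hM h0 h1 ha hroomW U gJ u₁ W hWV hz ν hs1 hs2, (hWA z hz ν).1]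
  exact norm_cfgExp_sub_one_le hη z ν (hWA z hz ν).2

/-! ## §4 The near-`1` row on the torus bonds of the top block of `x₀` (the `hW1near` shape of ✓`HalvingP1FlatCoreSupplierFramesSU2.hCsu_of_near`) -/

/-- A site of the top block of `x₀` lies in the route's cubes `□₀` and `□_k` (distance `0 ≤ radM` at level `k`, then the column lemma
✓`P1FlatCoreTopCubeGeometry.mem_cubeSetM_zero_of_dist_le`). [cite: Balaban1985Variational, (144) p.300] -/
theorem mem_cubeSetM_of_block_eq (x₀ : Site (F.P K) 0) (ρ S M : ℕ) (hM : 1 ≤ M) {s : Site (F.P K) 0}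
    (hs : iterBlockOf (K - n) s = iterBlockOf (K - n) x₀) :
    s ∈ cubeSetM x₀ (K - n) ρ S M 0 ∧ s ∈ cubeSetM x₀ (K - n) ρ S M (K - n) := by
  have hk : K - n ≤ (F.P K).m + (F.P K).K := FlatMinimizerH.le_T3 F n K
  have hd : distSite (Mk (F.P K) (K - n)) (iterBlockOf (K - n) s) (iterBlockOf (K - n) x₀) ≤ (radM (F.P K).L M ρ S (K - n - (K - n)) : ℝ) := by
    rw [hs, distSite_self]; exact Nat.cast_nonneg _
  refine ⟨mem_cubeSetM_zero_of_dist_le hM hk le_rfl hd, ?_⟩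
  simp only [cubeSetM, le_refl, if_true, Set.mem_setOf_eq]
  exact mem_cubeFinM_of_dist x₀ (K - n) ρ S M (K - n) hd

/-- ★ **`hW1near` FROM THEOREM 4's DATUM**: on every torus bond `b` of the top block of `x₀` the composite-gauged field is `(e^c − 1)`-close to `1`, given
`W = cfgExp η A` with `η‖A‖ ≤ c` on the bonds from `□_k = cube L a M′ ρ′ k k` (Theorem 4's (1.69)-type row at its deepest level, read on `□_k ⊆ Ω_{k−1}`;
there `c = O(c⋆·L·η)`, the `η`-small size ✓`hCsu_of_near_eta` budgets).  Geometry: the representative `lift x₀ + rel x₀ b₋` lies in `□_k`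
(✓`mem_cube_of_cover_mem_cubeSetM`) and `b = ⟨0 + rep b₋, dir⟩`. [cite: Balaban1985RegularSpaces, (1.36) p.82, (1.69) p.88; Balaban1985Variational, (144) p.300, (152) p.301] -/
theorem hW1near_of_datum (x₀ : Site (F.P K) 0) (ρ S M : ℕ) (hM : 1 ≤ M)
    {a : LSite (F.P K).d} {M' ρ' : ℕ} (h0 : ρ + M ≤ ρ' + 1) (h1 : (F.P K).L + S + M ≤ ρ' + 2)
    (ha : ∀ ν, a ν ≤ ((iterBlockOf (K - n) x₀ ν).val : ℤ) ∧ ((iterBlockOf (K - n) x₀ ν).val : ℤ) ≤ a ν + M' - 1)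
    (hroomW : 2 * ((F.P K).L ^ (K - n) * (M' + 1) + ρ' * gs (F.P K).L (K - n)) ≤ (F.P K).sitesPerDir 0)
    (U : GaugeField (F.P K) 0 (Matrix.specialUnitaryGroup (Fin 2) ℂ)) (gJ : GaugeTransf (F.P K) 0 (Matrix.specialUnitaryGroup (Fin 2) ℂ))
    (u₁ : LSite (F.P K).d → (Matrix (Fin 2) (Fin 2) ℂ)ˣ) (W : LSite (F.P K).d → Fin (F.P K).d → (Matrix (Fin 2) (Fin 2) ℂ)ˣ)
    (hWV : mgauge (1 : LSite (F.P K).d → Fin (F.P K).d → (Matrix (Fin 2) (Fin 2) ℂ)ˣ) u₁ W =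
      pull (unitsField (toUField (GaugeField.gaugeAct gJ U))) 0)
    {η : ℝ} (hη : 0 ≤ η) {A : LSite (F.P K).d → Fin (F.P K).d → Matrix (Fin 2) (Fin 2) ℂ} {c : ℝ}
    (hWA : ∀ z ∈ cube (F.P K).L a M' ρ' (K - n) (K - n), ∀ ν : Fin (F.P K).d, W z ν = cfgExp η A z ν ∧ η * ‖A z ν‖ ≤ c) :
    ∀ b : PBond (F.P K) 0, iterBlockOf (K - n) b.src = iterBlockOf (K - n) x₀ → iterBlockOf (K - n) b.tgt = iterBlockOf (K - n) x₀ →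
      ‖((gaugeActT (fun s => (u₁ (lift (F.P K) x₀ + rel x₀ s))⁻¹ * Unitary.toUnits (suIncl (gJ s)) : GaugeTransf (F.P K) 0 (Matrix (Fin 2) (Fin 2) ℂ)ˣ)
        (unitsField (toUField U)) b : (Matrix (Fin 2) (Fin 2) ℂ)ˣ) : Matrix (Fin 2) (Fin 2) ℂ) - 1‖ ≤ Real.exp c - 1 := by
  have hk : K - n ≤ (F.P K).m + (F.P K).K := FlatMinimizerH.le_T3 F n K
  rintro ⟨s, μ⟩ hsrc htgt
  obtain ⟨hs0, hsk⟩ := mem_cubeSetM_of_block_eq x₀ ρ S M hM hsrc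
  obtain ⟨ht0, -⟩ := mem_cubeSetM_of_block_eq x₀ ρ S M hM htgt
  -- the representative of `s` and its place in the cube tower
  have hz0 : lift (F.P K) x₀ + rel x₀ s ∈ cube (F.P K).L a M' ρ' (K - n) 0 := lift_add_rel_mem_cube_zero hk hM h0 h1 ha hs0
  have hcov : transl (0 : Site (F.P K) 0) (lift (F.P K) x₀ + rel x₀ s) = s := by rw [transl_zero_eq_cover, cover_lift_add_rel]
  have hzk : lift (F.P K) x₀ + rel x₀ s ∈ cube (F.P K).L a M' ρ' (K - n) (K - n) :=
    mem_cube_of_cover_mem_cubeSetM hk hM h0 h1 ha hroomW le_rfl hz0 (by rw [cover_lift_add_rel]; exact hsk)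
  have hs1 : transl (0 : Site (F.P K) 0) (lift (F.P K) x₀ + rel x₀ s) ∈ cubeSetM x₀ (K - n) ρ S M 0 := by rw [hcov]; exact hs0
  have hs2 : (transl (0 : Site (F.P K) 0) (lift (F.P K) x₀ + rel x₀ s)).shift μ ∈ cubeSetM x₀ (K - n) ρ S M 0 := by rw [hcov]; exact ht0
  have hb : (⟨s, μ⟩ : PBond (F.P K) 0) = ⟨transl 0 (lift (F.P K) x₀ + rel x₀ s), μ⟩ := by rw [hcov]
  rw [hb, gaugeActT_descent_eq_of_mgauge x₀ ρ S M hM h0 h1 ha hroomW U gJ u₁ W hWV hz0 μ hs1 hs2, (hWA _ hzk μ).1]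
  exact norm_cfgExp_sub_one_le hη _ μ (hWA _ hzk μ).2

end Torus

end Summit.QuantumFields.YangMills.Theorems.HalvingP1FlatCoreSupplierGaugeDescent

end
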